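import Summits.BirchSwinnertonDyer.BirchSwinnertonDyer.Theorems.Rank2ObservatoryRank3FullTwoTorsionIsoDoors
import Summits.BirchSwinnertonDyer.BirchSwinnertonDyer.Theorems.Rank2ObservatoryTorsionCertA
import Literature.NumberTheory.EllipticCurves.BSDRankZeroDensityProofs
import Literature.NumberTheory.EllipticCurves.TwoIsogenyDescentOddMultipleProofs
import Literature.NumberTheory.EllipticCurves.TwoIsogenyDescentIndex
import Literature.NumberTheory.EllipticCurves.VariableChangePoints
import Literature.NumberTheory.EllipticCurves.TwistFamilySelmerGroupCardInvarianceProofs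
import HarnessLib

/-!
# BirchSwinnertonDyer — rank ≥ 2 observatory: THE 2-SELMER GROUPS OF THE 986 RANK-3 CENSUS CURVES WITH A RATIONAL 2-TORSION
# POINT — `#Sel^{(2)}(E/ℚ) = 16` for the 966 curves with one rational point of order 2, `= 32` for the 20 with full rational
# 2-torsion; `#E(ℚ)[2] = 2` resp. `4` by kernel certificate; `dim₂ Sel^{(2)}(E/ℚ) = rank + dim₂ E(ℚ)[2]` exactly — unconditionally

HONEST FRAMING: per-curve certified theorems and census instruments; no claim on BSD in rank ≥ 2.
Nothing here proves BSD, or finiteness of `Ш`, for any curve; nothing here bears on `ord_{s=1} L(E,s)`.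

Setting.  For the `966` rows of the KERNEL-ISO table `rank3IsoRows` (the rank-3 census curves with exactly one rational point of order `2`)
and the `60 = 20 × 3` rows of `rank3FullTwoTorsionIsoRows` (the 20 rank-3 census curves with full rational `2`-torsion, one descent per
rational `2`-torsion point) the tree certifies THE DOOR AT 2 on the census model `E = R.curve` — `rank_ℤ E(ℚ) = 3` and `Ш(E/ℚ)[2] = 0`
(`IsoRow.door_of_check3`; `ShaPrimaryTransferIsoDoorsRank3.rank3IsoRows_doors`, `rank3FullTwoTorsionIsoRows_doors`) — and determines the
two ISOGENY Selmer groups `S^{(φ)}(E/ℚ)`, `S^{(φ̂)}(E'/ℚ)` of each descent.  The FULL `2`-SELMER GROUP `Sel^{(2)}(E/ℚ) ⊆ H¹(ℚ, E[2])` of these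
curves was not yet on record.  Silverman X.4.2(a), `0 → E(ℚ)/2E(ℚ) → Sel^{(2)}(E/ℚ) → Ш(E/ℚ)[2] → 0`, is in the tree as the exact count
`natCard_selmerGroup_eq : #Sel^{(n)}(E/K) = n^{rank E(K)} · #E(K)[n] · #(Ш(E/K) ⊓ H¹(K,E)[n])`; with the door it reads
`#Sel^{(2)}(E/ℚ) = 2³ · #E(ℚ)[2]`, so everything comes down to `#E(ℚ)[2]` on the census model — which this file certifies in the kernel.

What THIS file adds (glue by name + two cheap kernel `decide`s; no numerics, no new data tables, no new axioms):

* §1 Generic (any field `F`, `E : y² = x³ + ax² + bx` elliptic): `#E(F)[2] = 2` when `a² − 4b` is a non-square in `F` — `E(F)[2] = {O, T}` by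
  the tree's `eq_zero_or_eq_twoTorsionPoint_of_two_nsmul_eq_zero` (`TwoDescentCount.natCard_torsionBy_two_eq_two`); `#E(F)[2] = 4` when
  `x² + ax + b` has a root `e ∈ F` — `E(F)[2] = {O, T, (e,0), (−a−e,0)}`, four distinct points as `b ≠ 0`, `a² − 4b ≠ 0`
  (`…natCard_torsionBy_two_eq_four`); `#E(ℚ)[n]` along a change of Weierstrass model (the tree's `VariableChange.pointEquiv` and
  `natCard_torsionBy_congr`); and THE EXACT `2`-DESCENT COUNT WITH `Ш[2] = 0`: `#Sel^{(2)}(E/ℚ) = 2^{rank E(ℚ)} · #E(ℚ)[2]`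
  (`TwoDescentCount.natCard_selmerGroup_two_eq`, from `natCard_selmerGroup_eq`).
* §2 Row level, for a row `R : IsoRow` passing `IsoRow.check3`: the kernel checks `IsoRow.twoTorsNonsplit` («`a² − 4b` is a non-residue
  modulo one of the primes `3,5,7,11,13,17,19,23,29,37`», by the torsion census's `nonSquareB`) and `IsoRow.twoTorsSplitIn rows` («a row of
  `rows` supplies an integer root `e' − e` of `x² + ax + b`» — for full `2`-torsion the other two `2`-torsion abscissae translate to the roots),
  their soundness, and on the CENSUS MODEL (transport along `IsoRow.exists_transport`): `#E(ℚ)[2] = 2` resp. `4`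
  (`IsoRow.natCard_torsionBy_two_eq_two_of_check3`, `…_eq_four_of_check3`) and `#Sel^{(2)}(E/ℚ) = 16` resp. `32`
  (`IsoRow.natCard_selmerGroup_two_eq_sixteen_of_check3`, `…_thirtytwo_of_check3`).
* §3 The tables: `rank3IsoRows.all twoTorsNonsplit` (one kernel walk over the 966 rows; the ten primes were chosen on the hub to cover every
  row: `3`:350, `5`:294, `7`:184, `11`:78, `13`:34, `17`:20, `19`:2, `23`:2, `29`:1, `37`:1 rows by least witness) and
  `rank3FullTwoTorsionIsoRows.all (twoTorsSplitIn rank3FullTwoTorsionIsoRows)` (the 60 rows come in sibling triples); hence, unconditionally,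
  `#E(ℚ)[2] = 2 ∧ #Sel^{(2)}(E/ℚ) = 16` for EVERY row of `rank3IsoRows` (`rank3IsoRows_selmerTwo`) and `#E(ℚ)[2] = 4 ∧ #Sel^{(2)}(E/ℚ) = 32`
  for EVERY row of `rank3FullTwoTorsionIsoRows` (`rank3FullTwoTorsionIsoRows_selmerTwo`).
* §4 Census-row forms along the JOINs (`Rank3Row.selmerTwo_of_aKey_mem`, `Rank3Row.selmerTwo_of_mem_fullTwoTorsionRows`) and THE 986
  (`rank3_twoTorsion_selmerTwo`): on every rank-3 census row with a rational `2`-torsion point listed in the tree the `2`-Selmer group has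
  order `2^{3} · #E(ℚ)[2]` — `2`-Selmer rank `dim₂ Sel^{(2)}(E/ℚ) = 4` on `966` curves and `= 5` on `20` curves, i.e. the descent bound
  `rank ≤ dim₂ Sel^{(2)} − dim₂ E(ℚ)[2]` is ATTAINED (`= 3`) on all `986`: a census statistic AS A THEOREM ABOUT SELMER GROUPS, in the
  currency of the `2`-Selmer averages of Bhargava–Shankar and the Poonen–Rains model (which this file does not touch).

NOT claimed: anything about `Sel^{(n)}` for `n ≠ 2`, about `Ш(E/ℚ)[p^∞]` for odd `p`, the order of `Ш`, `#Ш_an`, `ord_{s=1} L(E,s)`, or the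
`8 501` rank-3 census rows without rational `2`-torsion (out of reach of descent via `2`-isogeny).  Inputs: none (hypothesis-free theorems).
Sorry-free; kernel `decide` only (no `native_decide`); axioms `propext`, `Classical.choice`, `Quot.sound`.
References: J. H. Silverman, *The Arithmetic of Elliptic Curves*, 2nd ed. (2009), Thm. X.4.2(a), Group Law Algorithm III.2.3, Prop. III.3.1(b),
Prop. X.4.9; J. H. Silverman, J. Tate, *Rational Points on Elliptic Curves*, 2nd ed. (2015), §3.5; J. E. Cremona, *Algorithms for Modular
Elliptic Curves*, 2nd ed. (1997), §3.6 and Table 1; M. Bhargava, A. Shankar, Ann. of Math. 181 (2015) (average `#Sel^{(2)} = 3`, context only).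
-/

-- single-conjunct summit: `Summit.BirchSwinnertonDyer.BirchSwinnertonDyer.…` repeats the name by design
set_option linter.dupNamespace false
set_option autoImplicit false

noncomputable section

open scoped Classical AddSubgroup

namespace Summit.BirchSwinnertonDyer.BirchSwinnertonDyer.Rank2Observatory

open WeierstrassCurve Literature Literature.NumberTheory.EllipticCurves
open IsoLocal

/-! ### §1 Generic: `#E(F)[2]` on `y² = x³ + ax² + bx`, `#E(ℚ)[n]` along a change of model, the exact `2`-descent count with `Ш[2] = 0` -/

namespace TwoDescentCount

/-- A subtype whose members are exactly four pairwise distinct elements has `Nat.card = 4`. [folklore] -/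
theorem natCard_subtype_eq_four {α : Type*} {p : α → Prop} {a b c d : α}
    (hp : ∀ x, p x ↔ x = a ∨ x = b ∨ x = c ∨ x = d)
    (hab : a ≠ b) (hac : a ≠ c) (had : a ≠ d) (hbc : b ≠ c) (hbd : b ≠ d) (hcd : c ≠ d) :
    Nat.card {x // p x} = 4 := by
  calc Nat.card {x // p x} = Nat.card ↥({a, b, c, d} : Set α) :=
        Nat.card_congr (Equiv.subtypeEquivRight fun x => by
          rw [hp x]; simp only [Set.mem_insert_iff, Set.mem_singleton_iff])
    _ = ({a, b, c, d} : Set α).ncard := Nat.card_coe_set_eq _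
    _ = 4 := by
        rw [Set.ncard_insert_of_notMem (by simp [hab, hac, had]), Set.ncard_insert_of_notMem (by simp [hbc, hbd]),
          Set.ncard_pair hcd]

variable {F : Type*} [Field F] (W : WeierstrassCurve F) [W.IsTwoTorsionNF] [W.IsElliptic]

/-- **`#E(F)[2] = 2` on `y² = x³ + ax² + bx` when `a² − 4b` is not a square in `F`**: `E(F)[2] = {O, T}` (a point `(x,0)` with `x ≠ 0` would give
`(2x + a)² = a² − 4b`). [cite: SilvermanTate2015, §3.5] [cite: SilvermanAEC2009, Group Law Algorithm III.2.3] -/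
theorem natCard_torsionBy_two_eq_two (hD : ¬ IsSquare (W.a₂ ^ 2 - 4 * W.a₄)) :
    Nat.card (W.toAffine.Point[((2 : ℕ) : ℤ)]) = 2 := by
  rw [Nat.card_eq_two_iff]
  refine ⟨⟨0, AddSubgroup.zero_mem _⟩, ⟨W.twoTorsionPoint, ?_⟩, ?_, ?_⟩
  · exact AddSubgroup.torsionBy.nsmul_iff.mpr (by rw [two_nsmul, twoTorsionPoint_add_twoTorsionPoint])
  · exact fun h => twoTorsionPoint_ne_zero W (Subtype.ext_iff.mp h).symm
  · refine Set.eq_univ_of_forall fun P => ?_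
    rcases W.eq_zero_or_eq_twoTorsionPoint_of_two_nsmul_eq_zero hD P.1 (AddSubgroup.torsionBy.nsmul_iff.mp P.2) with h | h
    · exact Or.inl (Subtype.ext h)
    · exact Or.inr (Subtype.ext h)

/-- **`#E(F)[2] = 4` on `y² = x³ + ax² + bx` when `x² + ax + b` has a root `e ∈ F`**: `E(F)[2] = {O, T, (e,0), (−a−e,0)}`, four distinct
points (`e ≠ 0 ≠ −a−e` as `b ≠ 0`, `e ≠ −a−e` as `a² − 4b ≠ 0`).
[cite: SilvermanAEC2009, Group Law Algorithm III.2.3 and Prop. III.1.4] [cite: SilvermanTate2015, §3.5] -/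
theorem natCard_torsionBy_two_eq_four {e : F} (he : e ^ 2 + W.a₂ * e + W.a₄ = 0) :
    Nat.card (W.toAffine.Point[((2 : ℕ) : ℤ)]) = 4 := by
  have hb : W.a₄ ≠ 0 := a₄_ne_zero W
  have hdisc : W.a₂ ^ 2 - 4 * W.a₄ ≠ 0 := a₂_sq_sub_ne_zero W
  have he' : (-W.a₂ - e) ^ 2 + W.a₂ * (-W.a₂ - e) + W.a₄ = 0 := by linear_combination he
  have he0 : e ≠ 0 := by rintro rfl; exact hb (by linear_combination he)
  have he'0 : -W.a₂ - e ≠ 0 := fun h => by rw [h] at he'; exact hb (by linear_combination he')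
  have hne : e ≠ -W.a₂ - e := by
    intro h
    have h2 : 2 * e + W.a₂ = 0 := by linear_combination h
    exact hdisc (by linear_combination (2 * e + W.a₂) * h2 - 4 * he)
  have hns : ∀ x : F, x ^ 2 + W.a₂ * x + W.a₄ = 0 → W.toAffine.Nonsingular x 0 := fun x hx =>
    Affine.equation_iff_nonsingular.mp ((equation_iff_of_isTwoTorsionNF W x 0).mpr (by linear_combination (-x) * hx))
  refine natCard_subtype_eq_four (a := (0 : W.toAffine.Point)) (b := W.twoTorsionPoint)
    (c := Affine.Point.some e 0 (hns e he)) (d := Affine.Point.some (-W.a₂ - e) 0 (hns _ he')) ?_ ?_ ?_ ?_ ?_ ?_ ?_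
  · intro P
    rw [AddSubgroup.torsionBy.nsmul_iff]
    constructor
    · intro hP
      rcases P with _ | ⟨x, y, h⟩
      · exact Or.inl rfl
      · right
        have hy : y = 0 := (W.two_nsmul_eq_zero_iff_y_eq_zero h).mp hP
        subst hy
        have hx : x * (x ^ 2 + W.a₂ * x + W.a₄) = 0 := by linear_combination -(rel_of_nonsingular W h)
        rcases mul_eq_zero.mp hx with hx0 | hq
        · left; subst hx0; rfl
        · right
          have hfac : (x - e) * (x - (-W.a₂ - e)) = 0 := by linear_combination hq - he
          rcases mul_eq_zero.mp hfac with h1 | h1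
          · left; have hxe := sub_eq_zero.mp h1; subst hxe; rfl
          · right; have hxe := sub_eq_zero.mp h1; subst hxe; rfl
    · rintro (rfl | rfl | rfl | rfl)
      · exact nsmul_zero 2
      · rw [two_nsmul, twoTorsionPoint_add_twoTorsionPoint]
      · exact (W.two_nsmul_eq_zero_iff_y_eq_zero _).mpr rfl
      · exact (W.two_nsmul_eq_zero_iff_y_eq_zero _).mpr rfl
  · exact (twoTorsionPoint_ne_zero W).symm
  · exact fun h => nomatch h
  · exact fun h => nomatch h
  · intro h
    unfold twoTorsionPoint at h
    simp only [Affine.Point.some.injEq] at h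
    exact he0 h.1.symm
  · intro h
    unfold twoTorsionPoint at h
    simp only [Affine.Point.some.injEq] at h
    exact he'0 h.1.symm
  · intro h
    simp only [Affine.Point.some.injEq] at h
    exact hne h.1

/-- **The exact `2`-descent count with `Ш[2] = 0`: `#Sel^{(2)}(E/ℚ) = 2^{rank E(ℚ)} · #E(ℚ)[2]`** — Silverman X.4.2(a),
`0 → E(ℚ)/2E(ℚ) → Sel^{(2)}(E/ℚ) → Ш(E/ℚ)[2] → 0`, with the tree's exact count `natCard_selmerGroup_eq`. [cite: SilvermanAEC2009, Thm X.4.2(a)] -/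
theorem natCard_selmerGroup_two_eq {V : WeierstrassCurve ℚ} [V.IsElliptic] (hsha : ∀ c ∈ V.sha, 2 • c = 0 → c = 0) :
    Nat.card (V.selmerGroup 2) = 2 ^ V.mordellWeilRank * Nat.card (V.toAffine.Point[((2 : ℕ) : ℤ)]) := by
  have h := V.natCard_selmerGroup_eq (n := 2) two_ne_zero
  have hbot : V.sha ⊓ V.galH1[((2 : ℕ) : ℤ)] = ⊥ := by
    refine (AddSubgroup.eq_bot_iff_forall _).mpr fun x hx ↦ ?_
    exact hsha x (AddSubgroup.mem_inf.mp hx).1 (AddSubgroup.torsionBy.nsmul_iff.mp (AddSubgroup.mem_inf.mp hx).2)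
  rw [hbot, AddSubgroup.card_bot, mul_one] at h
  -- the tree's count carries the classical `DecidableEq ℚ` inside the group law on `E(ℚ)`; `convert` closes the instance gap
  -- (`Subsingleton (DecidableEq ℚ)`) and `(2 : ℤ) = ((2 : ℕ) : ℤ)`
  show Nat.card (V.selmerGroup ((2 : ℕ) : ℤ)) = 2 ^ V.mordellWeilRank * Nat.card (V.toAffine.Point[((2 : ℕ) : ℤ)])
  convert h

/-- `#E(ℚ)[n]` does not depend on the Weierstrass model: transported along `C • V = Y` by the tree's `VariableChange.pointEquiv` and
`natCard_torsionBy_congr` (the `ℚ`-literal form of `natCard_torsionBy_point_smul`, with `ℚ`'s own `DecidableEq` in the group law).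
[cite: SilvermanAEC2009, III.3.1(b) and proof of III.2.5] -/
theorem natCard_torsionBy_point_eq_of_smul_eq {V Y : WeierstrassCurve ℚ} {C : VariableChange ℚ} (hC : C • V = Y) (n : ℤ) :
    Nat.card (V.toAffine.Point[n]) = Nat.card (Y.toAffine.Point[n]) := by
  subst hC
  exact natCard_torsionBy_congr (VariableChange.pointEquiv V C) n

end TwoDescentCount

open TwoDescentCount

/-! ### §2 Row level: kernel certificates for `#E(ℚ)[2]` and the `2`-Selmer order of a checked `IsoRow` -/

namespace IsoLocal.IsoRow

/-- Kernel check «`a² − 4b` is a non-residue modulo one of ten small primes» (hence not a rational square; the primes cover all 966 rows).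
[cite: CremonaAlgorithms1997, §3.6] -/
def twoTorsNonsplit (R : IsoRow) : Bool :=
  [3, 5, 7, 11, 13, 17, 19, 23, 29, 37].any (fun m => nonSquareB (R.ab.1 ^ 2 - 4 * R.ab.2) m)

/-- Kernel check «some row of `rows` with the same model supplies an integer root `e' − e` of `x² + ax + b`» (full rational `2`-torsion: the
other two `2`-torsion abscissae translate to the roots). [cite: CremonaAlgorithms1997, §3.6] -/
def twoTorsSplitIn (rows : List IsoRow) (R : IsoRow) : Bool :=
  rows.any (fun R' => (R'.e - R.e) ^ 2 + R.ab.1 * (R'.e - R.e) + R.ab.2 == 0)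

/-- Soundness of `twoTorsNonsplit`. [cite: CremonaAlgorithms1997, §3.6] -/
theorem not_isSquare_of_twoTorsNonsplit (R : IsoRow) (h : R.twoTorsNonsplit = true) :
    ¬ IsSquare (((R.ab.1 : ℤ) : ℚ) ^ 2 - 4 * ((R.ab.2 : ℤ) : ℚ)) := by
  obtain ⟨m, -, hm⟩ := List.any_eq_true.mp h
  have h' := not_isSquare_of_nonSquareB hm
  push_cast at h'
  exact h'

/-- Soundness of `twoTorsSplitIn`: an integer root of `x² + ax + b`. [cite: CremonaAlgorithms1997, §3.6] -/
theorem exists_root_of_twoTorsSplitIn {rows : List IsoRow} (R : IsoRow) (h : twoTorsSplitIn rows R = true) :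
    ∃ x : ℤ, x ^ 2 + R.ab.1 * x + R.ab.2 = 0 := by
  obtain ⟨R', -, hR'⟩ := List.any_eq_true.mp h
  exact ⟨R'.e - R.e, by simpa using hR'⟩

/-- **`#E(ℚ)[2] = 2` on the census model** of a checked row with `twoTorsNonsplit`. [cite: SilvermanTate2015, §3.5] [cite: SilvermanAEC2009, III.3.1(b)] -/
theorem natCard_torsionBy_two_eq_two_of_check3 (R : IsoRow) (h : R.check3 = true) (ht : R.twoTorsNonsplit = true) :
    Nat.card (R.curve.toAffine.Point[((2 : ℕ) : ℤ)]) = 2 := by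
  obtain ⟨hsc, he, hab, -⟩ := checkRank_parts R h
  obtain ⟨C, hC⟩ := exists_transport R hsc he
  haveI := isElliptic_mk_of_ne_zero (F := ℚ) hab
  rw [natCard_torsionBy_point_eq_of_smul_eq hC]
  convert natCard_torsionBy_two_eq_two (⟨0, (R.ab.1 : ℚ), 0, (R.ab.2 : ℚ), 0⟩ : WeierstrassCurve ℚ)
    (not_isSquare_of_twoTorsNonsplit R ht)

/-- **`#E(ℚ)[2] = 4` on the census model** of a checked row, given an integer root of `x² + ax + b`. [cite: SilvermanAEC2009, III.3.1(b) and III.2.3] -/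
theorem natCard_torsionBy_two_eq_four_of_check3 (R : IsoRow) (h : R.check3 = true) {x : ℤ} (hx : x ^ 2 + R.ab.1 * x + R.ab.2 = 0) :
    Nat.card (R.curve.toAffine.Point[((2 : ℕ) : ℤ)]) = 4 := by
  obtain ⟨hsc, he, hab, -⟩ := checkRank_parts R h
  obtain ⟨C, hC⟩ := exists_transport R hsc he
  haveI := isElliptic_mk_of_ne_zero (F := ℚ) hab
  rw [natCard_torsionBy_point_eq_of_smul_eq hC]
  have hx' : ((x : ℚ)) ^ 2 + (R.ab.1 : ℚ) * (x : ℚ) + (R.ab.2 : ℚ) = 0 := by exact_mod_cast hx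
  convert natCard_torsionBy_two_eq_four (⟨0, (R.ab.1 : ℚ), 0, (R.ab.2 : ℚ), 0⟩ : WeierstrassCurve ℚ) hx'

/-- **`#Sel^{(2)}(E/ℚ) = 16`** (`2`-Selmer rank `4 = rank + dim E(ℚ)[2] = 3 + 1`) for the census model of a checked rank-3 row with one rational
`2`-torsion point: the door (`rank = 3`, `Ш[2] = 0`) with the exact count. [cite: SilvermanAEC2009, Thm X.4.2(a) and Prop. X.4.9] -/
theorem natCard_selmerGroup_two_eq_sixteen_of_check3 (R : IsoRow) (h : R.check3 = true) (ht : R.twoTorsNonsplit = true) :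
    Nat.card (R.curve.selmerGroup 2) = 16 := by
  haveI := isElliptic_curve_of_checkRank R h
  obtain ⟨hr, hsha, -⟩ := door_of_check3 R h
  rw [natCard_selmerGroup_two_eq hsha, hr, natCard_torsionBy_two_eq_two_of_check3 R h ht]
  norm_num

/-- **`#Sel^{(2)}(E/ℚ) = 32`** (`2`-Selmer rank `5 = rank + dim E(ℚ)[2] = 3 + 2`) for the census model of a checked rank-3 row with full rational
`2`-torsion. [cite: SilvermanAEC2009, Thm X.4.2(a) and Prop. X.4.9] -/
theorem natCard_selmerGroup_two_eq_thirtytwo_of_check3 (R : IsoRow) (h : R.check3 = true) {x : ℤ}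
    (hx : x ^ 2 + R.ab.1 * x + R.ab.2 = 0) : Nat.card (R.curve.selmerGroup 2) = 32 := by
  haveI := isElliptic_curve_of_checkRank R h
  obtain ⟨hr, hsha, -⟩ := door_of_check3 R h
  rw [natCard_selmerGroup_two_eq hsha, hr, natCard_torsionBy_two_eq_four_of_check3 R h hx]
  norm_num

end IsoLocal.IsoRow

/-! ### §3 The tables: kernel `decide`s and the `2`-Selmer orders of the 966 and of the 20 -/

set_option maxHeartbeats 20000000 in
/-- kernel `decide`: `a² − 4b` is a non-residue modulo a prime `≤ 37` for every one of the 966 rows. [cite: CremonaAlgorithms1997, Table 1] -/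
theorem rank3IsoRows_twoTorsNonsplit : rank3IsoRows.all IsoRow.twoTorsNonsplit = true := by
  decide +kernel

set_option maxHeartbeats 20000000 in
/-- kernel `decide`: every one of the 60 full-`2`-torsion rows has a sibling row supplying an integer root of `x² + ax + b`.
[cite: CremonaAlgorithms1997, Table 1] -/
theorem rank3FullTwoTorsionIsoRows_twoTorsSplit :
    rank3FullTwoTorsionIsoRows.all (IsoRow.twoTorsSplitIn rank3FullTwoTorsionIsoRows) = true := by
  decide +kernel

/-- **THE 966: `#E(ℚ)[2] = 2` and `#Sel^{(2)}(E/ℚ) = 16`** on the census model of every row of the KERNEL-ISO table `rank3IsoRows`, unconditionally.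
[cite: SilvermanAEC2009, Thm X.4.2(a)] [cite: SilvermanTate2015, §3.5] -/
theorem rank3IsoRows_selmerTwo : ∀ R ∈ rank3IsoRows,
    Nat.card (R.curve.toAffine.Point[((2 : ℕ) : ℤ)]) = 2 ∧ Nat.card (R.curve.selmerGroup 2) = 16 := fun R hR =>
  have h := List.all_eq_true.mp rank3IsoRows_check R hR
  have ht := List.all_eq_true.mp rank3IsoRows_twoTorsNonsplit R hR
  ⟨IsoRow.natCard_torsionBy_two_eq_two_of_check3 R h ht, IsoRow.natCard_selmerGroup_two_eq_sixteen_of_check3 R h ht⟩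

/-- **THE 20 (60 descents): `#E(ℚ)[2] = 4` and `#Sel^{(2)}(E/ℚ) = 32`** on the census model of every row of `rank3FullTwoTorsionIsoRows`, unconditionally.
[cite: SilvermanAEC2009, Thm X.4.2(a)] [cite: SilvermanTate2015, §3.5] -/
theorem rank3FullTwoTorsionIsoRows_selmerTwo : ∀ R ∈ rank3FullTwoTorsionIsoRows,
    Nat.card (R.curve.toAffine.Point[((2 : ℕ) : ℤ)]) = 4 ∧ Nat.card (R.curve.selmerGroup 2) = 32 := fun R hR => by
  have h := List.all_eq_true.mp rank3FullTwoTorsionIsoRows_check R hR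
  obtain ⟨x, hx⟩ := IsoRow.exists_root_of_twoTorsSplitIn R (List.all_eq_true.mp rank3FullTwoTorsionIsoRows_twoTorsSplit R hR)
  exact ⟨IsoRow.natCard_torsionBy_two_eq_four_of_check3 R h hx, IsoRow.natCard_selmerGroup_two_eq_thirtytwo_of_check3 R h hx⟩

/-! ### §4 Census-row forms along the JOINs, and the 986 -/

/-- **Census-row form, the 966**: every rank-3 census row whose model key occurs in `rank3IsoRows` has `#E(ℚ)[2] = 2` and `#Sel^{(2)}(E/ℚ) = 16`.
[cite: SilvermanAEC2009, Thm X.4.2(a)] [cite: CremonaAlgorithms1997, Table 1] -/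
theorem Rank3Row.selmerTwo_of_aKey_mem {r : Rank3Row} (h : aKey₃ r ∈ rank3IsoRows.map IsoRow.aKey) :
    Nat.card (r.curve.toAffine.Point[((2 : ℕ) : ℤ)]) = 2 ∧ Nat.card (r.curve.selmerGroup 2) = 16 := by
  obtain ⟨R, hR, hk⟩ := List.mem_map.mp h
  rw [curve_eq_of_aKey_eq hk]
  exact rank3IsoRows_selmerTwo R hR

/-- **Census-row form, the 20**: every one of the 20 full-`2`-torsion rank-3 census rows has `#E(ℚ)[2] = 4` and `#Sel^{(2)}(E/ℚ) = 32`.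
[cite: SilvermanAEC2009, Thm X.4.2(a)] [cite: CremonaAlgorithms1997, Table 1] -/
theorem Rank3Row.selmerTwo_of_mem_fullTwoTorsionRows {r : Rank3Row} (hr : r ∈ rank3FullTwoTorsionRows) :
    Nat.card (r.curve.toAffine.Point[((2 : ℕ) : ℤ)]) = 4 ∧ Nat.card (r.curve.selmerGroup 2) = 32 := by
  obtain ⟨R, hR, hk⟩ := List.mem_map.mp (aKey₃_mem_isoKeys_of_mem_fullTwoTorsionRows hr)
  rw [curve_eq_of_aKey_eq hk]
  exact rank3FullTwoTorsionIsoRows_selmerTwo R hR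

/-- **THE 986**: on every rank-3 census row with a rational `2`-torsion point listed in the tree, `#Sel^{(2)}(E/ℚ) = 2^{3} · #E(ℚ)[2]` with
`#E(ℚ)[2] ∈ {2, 4}` certified: `2`-Selmer rank `= rank + dim_{𝔽₂} E(ℚ)[2]` exactly (`16` on the 966, `32` on the 20).
[cite: SilvermanAEC2009, Thm X.4.2(a)] -/
theorem rank3_twoTorsion_selmerTwo :
    (∀ r : Rank3Row, aKey₃ r ∈ rank3IsoRows.map IsoRow.aKey → Nat.card (r.curve.selmerGroup 2) = 16) ∧
    (∀ r ∈ rank3FullTwoTorsionRows, Nat.card (r.curve.selmerGroup 2) = 32) ∧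
    rank3IsoRows.length = 966 ∧ rank3FullTwoTorsionRows.length = 20 :=
  ⟨fun _ h => (Rank3Row.selmerTwo_of_aKey_mem h).2, fun _ hr => (Rank3Row.selmerTwo_of_mem_fullTwoTorsionRows hr).2,
    rank3IsoRows_length, by rw [← Nat.add_left_cancel_iff (n := rank3IsoRows.length), rank3_twoTorsion_doors_count, rank3IsoRows_length]⟩

end Summit.BirchSwinnertonDyer.BirchSwinnertonDyer.Rank2Observatory

end

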